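import Mathlib
import HarnessLib
import Literature.Analysis.FluidPDE.NSBoundedMildOseenDuhamel
import Literature.Analysis.UnboundedOperators.HeatKernelBoundedData
import Literature.Analysis.UnboundedOperators.HeatKernelGradient

/-!
# Route `PoloidalWindowDoor`, crux `PoloidalWindowRigidity` (K2, stmt-NavierStokesRegularity-19708) —
# THE OSEEN KERNEL AGAINST A SCALAR BUMP: heat part, projector part, and the two `L¹` rates

Cell ns-regularity-ideate, seat nsreg-p7 (gen 6, third worker under the K2 lead; `--supports stmt-…-19708`).
Kernel-side brick of the discharge of the K2 lead's hypothesis (F1) (`…LargeScaleEnergy`, `hBMO`): the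
large-scale momentum conservation of the Type-I mild class (sibling `…LargeScaleMomentum`) tests the Oseen-mild
identity (M) against a wide scalar bump `θ e` — NEITHER divergence free NOR a gradient (the tree's
`integral_inner_oseenKernel_comp_sub_of_isDivFree` / `…_gradient` cover those, and both are blind to the drift
`c(t)e₃` of the negative lane).  With `K(σ,z)[a,b] = (D_aG_σ)(z) b + ∫_σ^∞ Θ_s(z)[a,b] ds`, `Θ_s = ∇D_aD_bG_s`
(`oseenKernel_eq_fderiv_smul_add_integral`), the pairing `∫⟪K(σ, x − y)[a,b], θ(x)e⟫dx` splits into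
* the HEAT PART `−⟪b,e⟫ ∫ G_σ(x − y) ∂ₐθ(x) dx` (`heatPart_eq`, `abs_heatPart_le`);
* the PROJECTOR SLICES `∫ ⟪Θ_s(x − y)[a,b], e⟫ θ(x) dx = ∫ (D_bG_s)(x − y) D²θ(x)(a,e) dx` (`projSlice_eq`, two
  integrations by parts), with the NEAR bound `|a||b||e| ∫ ‖DG_s(x−y)‖ ‖D²θ(x)‖` (`abs_projSlice_le_near`; rate
  `‖DG_s‖₁ ≤ 2^{3/2}s^{-1/2}` in the tree) and the FAR bound `|a||b||e| ∫ m_s(x − y)|θ(x)|` (`abs_projSlice_le_far`)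
  through the scalar majorant `m_s(z) = 3G_s(z)|z|/(4s²) + G_s(z)|z|³/(8s³)` of `‖Θ_s(z)[a,b]‖`, of mass
  `∫ m_s ≤ K_Θ s^{-3/2}` (`integrable_majorant_and_integral_le`: third Gaussian moment through
  `‖∇G_t‖ ≤ 2^{3/2}t^{-1/2}G_{2t}` twice and the first moment).
The rates `s^{-1/2}‖D²θ‖₁` (integrable at `0`) and `s^{-3/2}‖θ‖₁` (integrable at `∞`) make the projector
contribution of a bump of width `R` an `O(1/R)` uniformly in `σ` (assembled in the sibling file).

WHAT THIS IS NOT: not a claim about Navier–Stokes regularity and not the open residue S2⁗ — Gaussian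
calculus for the Oseen kernel (bears_on LADDER-NS N0 via crux K2 = stmt-19708; whole-class tool).
-/

noncomputable section

-- the summit and its single sub-problem share the name (CONVENTIONS §1), as in every Theorems file
set_option linter.dupNamespace false
-- nested operator types `ℝ³ →L[ℝ] ℝ³ →L[ℝ] ℝ` (as in `LocalPressureLiouvilleKernel.lean`)
set_option maxSynthPendingDepth 3

namespace Summit.NavierStokesRegularity.NavierStokesRegularity.Theorems.PoloidalWindowDoorPoloidalWindowRigidityOseenBumpPairing

open MeasureTheory Set Function Filter Topology Metric InnerProductSpace
open scoped RealInnerProductSpace ENNReal NNReal Laplacian ContDiff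
open Literature.Analysis Literature.Analysis.FluidPDE Literature.Analysis.UnboundedOperators

/-! ## Gaussian moments: the scalar majorant of `Θ_s` and its mass `O(s^{-3/2})` -/

/-- The dimensional constant `2^{d/2}` of the tree's gradient bounds, `d = 3`. -/
theorem two_rpow_pos : (0 : ℝ) < (2 : ℝ) ^ ((Module.finrank ℝ (EuclideanSpace ℝ (Fin 3)) : ℝ) / 2) := by
  positivity

/-- **First moment, pointwise:** `G_s(z)‖z‖ ≤ 2·2^{d/2}·(s·s^{-1/2})·G_{2s}(z)` (`G_s‖z‖ = 2s‖∇G_s‖` and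
the tree's `‖∇G_s‖ ≤ 2^{d/2}s^{-1/2}G_{2s}`). [folklore] -/
theorem heatKernel_mul_norm_le {s : ℝ} (hs : 0 < s) (z : EuclideanSpace ℝ (Fin 3)) :
    heatKernel s z * ‖z‖ ≤
      2 * (2 : ℝ) ^ ((Module.finrank ℝ (EuclideanSpace ℝ (Fin 3)) : ℝ) / 2) * (s * s ^ (-(1 / 2 : ℝ))) *
        heatKernel (2 * s) z := by
  have h1 : heatKernel s z * ‖z‖ = 2 * s * ‖fderiv ℝ (heatKernel s) z‖ := by
    rw [norm_fderiv_heatKernel hs z]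
    field_simp
  rw [h1]
  have h2 := norm_fderiv_heatKernel_le_heatKernel_two_mul hs z
  calc 2 * s * ‖fderiv ℝ (heatKernel s) z‖
      ≤ 2 * s * ((2 : ℝ) ^ ((Module.finrank ℝ (EuclideanSpace ℝ (Fin 3)) : ℝ) / 2) * s ^ (-(1 / 2 : ℝ)) *
          heatKernel (2 * s) z) := mul_le_mul_of_nonneg_left h2 (by positivity)
    _ = _ := by ring

/-- **Third moment, pointwise:** `G_s(z)‖z‖³ ≤ 64·(2^{d/2})²·s³·(s^{-1/2})²·G_{4s}(z)‖z‖`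
(the first-moment comparison applied at the scales `s` and `2s`; `(2s)^{-1/2} ≤ s^{-1/2}`). [folklore] -/
theorem heatKernel_mul_norm_pow_three_le {s : ℝ} (hs : 0 < s) (z : EuclideanSpace ℝ (Fin 3)) :
    heatKernel s z * ‖z‖ ^ 3 ≤
      16 * ((2 : ℝ) ^ ((Module.finrank ℝ (EuclideanSpace ℝ (Fin 3)) : ℝ) / 2)) ^ 2 *
        (s ^ 2 * (s ^ (-(1 / 2 : ℝ))) ^ 2) * (heatKernel (4 * s) z * ‖z‖) := by
  set c : ℝ := (2 : ℝ) ^ ((Module.finrank ℝ (EuclideanSpace ℝ (Fin 3)) : ℝ) / 2) with hc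
  have hc0 : 0 < c := two_rpow_pos
  have h2s : 0 < 2 * s := by positivity
  have hA := heatKernel_mul_norm_le hs z
  have hB := heatKernel_mul_norm_le h2s z
  have hG4 : 0 ≤ heatKernel (4 * s) z := (heatKernel_pos (by positivity) z).le
  have hρ : (2 * s) ^ (-(1 / 2 : ℝ)) ≤ s ^ (-(1 / 2 : ℝ)) :=
    Real.rpow_le_rpow_of_nonpos hs (by linarith) (by norm_num)
  have hρ0 : 0 ≤ s ^ (-(1 / 2 : ℝ)) := Real.rpow_nonneg hs.le _
  have h44 : (2 : ℝ) * (2 * s) = 4 * s := by ring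
  rw [h44] at hB
  calc heatKernel s z * ‖z‖ ^ 3 = (heatKernel s z * ‖z‖) * ‖z‖ * ‖z‖ := by ring
    _ ≤ (2 * c * (s * s ^ (-(1 / 2 : ℝ))) * heatKernel (2 * s) z) * ‖z‖ * ‖z‖ := by
        gcongr
    _ = 2 * c * (s * s ^ (-(1 / 2 : ℝ))) * (heatKernel (2 * s) z * ‖z‖) * ‖z‖ := by ring
    _ ≤ 2 * c * (s * s ^ (-(1 / 2 : ℝ))) *
          (2 * c * ((2 * s) * (2 * s) ^ (-(1 / 2 : ℝ))) * heatKernel (4 * s) z) * ‖z‖ := by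
        gcongr
    _ ≤ 2 * c * (s * s ^ (-(1 / 2 : ℝ))) *
          (2 * c * ((2 * s) * s ^ (-(1 / 2 : ℝ))) * heatKernel (4 * s) z) * ‖z‖ := by
        gcongr
    _ = 8 * c ^ 2 * (s ^ 2 * (s ^ (-(1 / 2 : ℝ))) ^ 2) * (heatKernel (4 * s) z * ‖z‖) := by ring
    _ ≤ 16 * c ^ 2 * (s ^ 2 * (s ^ (-(1 / 2 : ℝ))) ^ 2) * (heatKernel (4 * s) z * ‖z‖) := by
        have : 0 ≤ c ^ 2 * (s ^ 2 * (s ^ (-(1 / 2 : ℝ))) ^ 2) * (heatKernel (4 * s) z * ‖z‖) := by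
          positivity
        nlinarith

/-- The **scalar majorant of the projector integrand**: `m_s(z) = 3G_s(z)‖z‖/(4s²) + G_s(z)‖z‖³/(8s³)`,
written inline (no definition): `‖Θ_s(z)[a,b]‖ ≤ m_s(z)‖a‖‖b‖` for `s > 0` (the tree's
`norm_oseenIntegrand_le` with `|G_s| = G_s`, `|s| = s`). [cite: KochTataruAdvMath2001, §2 (8)] -/
theorem norm_oseenIntegrand_le_majorant {s : ℝ} (hs : 0 < s) (z a b : EuclideanSpace ℝ (Fin 3)) :
    ‖oseenIntegrand s z a b‖ ≤
      (3 * (heatKernel s z / (4 * s ^ 2)) * ‖z‖ + heatKernel s z / (8 * s ^ 3) * ‖z‖ ^ 3) * ‖a‖ * ‖b‖ := by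
  have h := norm_oseenIntegrand_le s z a b
  rwa [abs_of_pos (heatKernel_pos hs z), abs_of_pos hs] at h

/-- The majorant is nonnegative for `s > 0`. -/
theorem majorant_nonneg {s : ℝ} (hs : 0 < s) (z : EuclideanSpace ℝ (Fin 3)) :
    0 ≤ 3 * (heatKernel s z / (4 * s ^ 2)) * ‖z‖ + heatKernel s z / (8 * s ^ 3) * ‖z‖ ^ 3 := by
  have := (heatKernel_pos hs z).le
  positivity

/-- The majorant is continuous. -/
theorem continuous_majorant (s : ℝ) :
    Continuous fun z : EuclideanSpace ℝ (Fin 3) =>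
      3 * (heatKernel s z / (4 * s ^ 2)) * ‖z‖ + heatKernel s z / (8 * s ^ 3) * ‖z‖ ^ 3 := by
  have hG : Continuous (heatKernel (E := EuclideanSpace ℝ (Fin 3)) s) := continuous_heatKernel s
  fun_prop

/-- **Integrability and mass of the majorant:** `∫ m_s ≤ K_Θ · (s^{-1/2})³` with
`K_Θ = (3/2)·2^{d/2} + 8·64·(2^{d/2})³` (first moment `∫G_t‖z‖ ≤ 2·2^{d/2}t^{1/2}` of the tree at the scales
`s` and `4s`, and `heatKernel_mul_norm_pow_three_le`). [folklore] -/
theorem integrable_majorant_and_integral_le {s : ℝ} (hs : 0 < s) :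
    Integrable (fun z : EuclideanSpace ℝ (Fin 3) =>
      3 * (heatKernel s z / (4 * s ^ 2)) * ‖z‖ + heatKernel s z / (8 * s ^ 3) * ‖z‖ ^ 3) volume ∧
    ∫ z : EuclideanSpace ℝ (Fin 3),
        (3 * (heatKernel s z / (4 * s ^ 2)) * ‖z‖ + heatKernel s z / (8 * s ^ 3) * ‖z‖ ^ 3) ≤
      ((3 / 2) * (2 : ℝ) ^ ((Module.finrank ℝ (EuclideanSpace ℝ (Fin 3)) : ℝ) / 2) +
        8 * 64 * ((2 : ℝ) ^ ((Module.finrank ℝ (EuclideanSpace ℝ (Fin 3)) : ℝ) / 2)) ^ 3) *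
        (s ^ (-(1 / 2 : ℝ))) ^ 3 := by
  set c : ℝ := (2 : ℝ) ^ ((Module.finrank ℝ (EuclideanSpace ℝ (Fin 3)) : ℝ) / 2) with hc
  have hc0 : 0 < c := two_rpow_pos
  set ρ : ℝ := s ^ (-(1 / 2 : ℝ)) with hρ
  have hρ0 : 0 < ρ := Real.rpow_pos_of_pos hs _
  have h4s : 0 < 4 * s := by positivity
  -- `ρ² = 1/s`
  have hρ2 : ρ ^ 2 = s⁻¹ := by
    rw [hρ, ← Real.rpow_natCast, ← Real.rpow_mul hs.le]
    norm_num
    rw [Real.rpow_neg_one]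
  -- first moments at the scales `s` and `4s`
  have hm1 : ∫ z : EuclideanSpace ℝ (Fin 3), heatKernel s z * ‖z‖ ≤ 2 * c * s ^ (1 / 2 : ℝ) :=
    integral_heatKernel_mul_norm_le hs
  have hm4 : ∫ z : EuclideanSpace ℝ (Fin 3), heatKernel (4 * s) z * ‖z‖ ≤ 2 * c * (4 * s) ^ (1 / 2 : ℝ) :=
    integral_heatKernel_mul_norm_le h4s
  have hi1 : Integrable (fun z : EuclideanSpace ℝ (Fin 3) => heatKernel s z * ‖z‖) volume :=
    integrable_heatKernel_mul_norm hs
  have hi4 : Integrable (fun z : EuclideanSpace ℝ (Fin 3) => heatKernel (4 * s) z * ‖z‖) volume :=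
    integrable_heatKernel_mul_norm h4s
  -- the cubic term is dominated by the first moment at scale `4s`
  set A : ℝ := 16 * c ^ 2 * (s ^ 2 * ρ ^ 2) with hA
  have hA0 : 0 ≤ A := by positivity
  have hcub : ∀ z : EuclideanSpace ℝ (Fin 3), heatKernel s z * ‖z‖ ^ 3 ≤ A * (heatKernel (4 * s) z * ‖z‖) :=
    fun z => heatKernel_mul_norm_pow_three_le hs z
  have hi3 : Integrable (fun z : EuclideanSpace ℝ (Fin 3) => heatKernel s z * ‖z‖ ^ 3) volume := by
    refine Integrable.mono' (hi4.const_mul A) ?_ (Eventually.of_forall fun z => ?_)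
    · exact ((continuous_heatKernel s).mul (continuous_norm.pow 3)).aestronglyMeasurable
    · rw [Real.norm_of_nonneg (by have := (heatKernel_pos hs z).le; positivity)]
      exact hcub z
  have hiT1 : Integrable (fun z : EuclideanSpace ℝ (Fin 3) => 3 * (heatKernel s z / (4 * s ^ 2)) * ‖z‖) volume := by
    have h := hi1.const_mul (3 / (4 * s ^ 2))
    refine h.congr (Eventually.of_forall fun z => ?_)
    simp only; ring
  have hiT2 : Integrable (fun z : EuclideanSpace ℝ (Fin 3) => heatKernel s z / (8 * s ^ 3) * ‖z‖ ^ 3) volume := by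
    have h := hi3.const_mul (1 / (8 * s ^ 3))
    refine h.congr (Eventually.of_forall fun z => ?_)
    simp only; ring
  refine ⟨hiT1.add hiT2, ?_⟩
  rw [integral_add hiT1 hiT2]
  -- evaluate the two pieces
  have hT1 : ∫ z : EuclideanSpace ℝ (Fin 3), 3 * (heatKernel s z / (4 * s ^ 2)) * ‖z‖ =
      3 / (4 * s ^ 2) * ∫ z : EuclideanSpace ℝ (Fin 3), heatKernel s z * ‖z‖ := by
    rw [← integral_const_mul]
    refine integral_congr_ae (Eventually.of_forall fun z => ?_)
    simp only; ring
  have hT2 : ∫ z : EuclideanSpace ℝ (Fin 3), heatKernel s z / (8 * s ^ 3) * ‖z‖ ^ 3 =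
      1 / (8 * s ^ 3) * ∫ z : EuclideanSpace ℝ (Fin 3), heatKernel s z * ‖z‖ ^ 3 := by
    rw [← integral_const_mul]
    refine integral_congr_ae (Eventually.of_forall fun z => ?_)
    simp only; ring
  have hI3 : ∫ z : EuclideanSpace ℝ (Fin 3), heatKernel s z * ‖z‖ ^ 3 ≤ A * (2 * c * (4 * s) ^ (1 / 2 : ℝ)) := by
    calc ∫ z : EuclideanSpace ℝ (Fin 3), heatKernel s z * ‖z‖ ^ 3
        ≤ ∫ z : EuclideanSpace ℝ (Fin 3), A * (heatKernel (4 * s) z * ‖z‖) :=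
          integral_mono hi3 (hi4.const_mul A) hcub
      _ = A * ∫ z : EuclideanSpace ℝ (Fin 3), heatKernel (4 * s) z * ‖z‖ := integral_const_mul _ _
      _ ≤ A * (2 * c * (4 * s) ^ (1 / 2 : ℝ)) := mul_le_mul_of_nonneg_left hm4 hA0
  -- `s^{1/2} = s ρ`, `(4s)^{1/2} ≤ 4 s ρ`
  have hhalf : s ^ (1 / 2 : ℝ) = s * ρ := by
    rw [hρ, show s * s ^ (-(1 / 2 : ℝ)) = s ^ (1 : ℝ) * s ^ (-(1 / 2 : ℝ)) by rw [Real.rpow_one],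
      ← Real.rpow_add hs]
    norm_num
  have hhalf4 : (4 * s) ^ (1 / 2 : ℝ) ≤ 4 * s * ρ := by
    have e1 : (4 * s) ^ (1 / 2 : ℝ) = (4 * s) ^ (1 : ℝ) * (4 * s) ^ (-(1 / 2 : ℝ)) := by
      rw [← Real.rpow_add h4s]; norm_num
    rw [e1, Real.rpow_one]
    refine mul_le_mul_of_nonneg_left ?_ h4s.le
    exact Real.rpow_le_rpow_of_nonpos hs (by linarith) (by norm_num)
  rw [hT1, hT2]
  have hsne : s ≠ 0 := hs.ne'
  have e1 : 3 / (4 * s ^ 2) * (2 * c * s ^ (1 / 2 : ℝ)) = (3 / 2) * c * ρ ^ 3 := by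
    rw [hhalf, show ρ ^ 3 = ρ ^ 2 * ρ by ring, hρ2]
    field_simp
    ring
  have e2 : 1 / (8 * s ^ 3) * (A * (2 * c * (4 * s * ρ))) = 16 * c ^ 3 * ρ ^ 3 := by
    have h8 : (8 : ℝ) * s ^ 3 ≠ 0 := by positivity
    rw [hA, one_div, inv_mul_eq_div, div_eq_iff h8]
    ring
  calc 3 / (4 * s ^ 2) * (∫ z : EuclideanSpace ℝ (Fin 3), heatKernel s z * ‖z‖) +
        1 / (8 * s ^ 3) * ∫ z : EuclideanSpace ℝ (Fin 3), heatKernel s z * ‖z‖ ^ 3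
      ≤ 3 / (4 * s ^ 2) * (2 * c * s ^ (1 / 2 : ℝ)) + 1 / (8 * s ^ 3) * (A * (2 * c * (4 * s * ρ))) := by
        gcongr
        exact hI3.trans (by gcongr)
    _ = (3 / 2) * c * ρ ^ 3 + 16 * c ^ 3 * ρ ^ 3 := by rw [e1, e2]
    _ ≤ ((3 / 2) * c + 8 * 64 * c ^ 3) * ρ ^ 3 := by
        have : 0 ≤ c ^ 3 * ρ ^ 3 := by positivity
        nlinarith

/-! ## The projector slice and the heat part against a scalar bump -/

section Pairing

variable {θ : EuclideanSpace ℝ (Fin 3) → ℝ}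

/-- **The projector slice after two integrations by parts**:
`∫ ⟪Θ_s(x − y)[a,b], θ(x)e⟫ dx = ∫ (D_bG_s)(x − y) · D(∂ₑθ)(x)(a) dx`
(`Θ_s = ∇(D_aD_bG_s)`: the gradient falls on `θ`, then `D_a` falls on `∂ₑθ`; no boundary terms, `θ` being
compactly supported — the tree's `integral_fderiv_comp_sub_mul`). [cite: KochTataruAdvMath2001, §2 (8)] -/
theorem projSlice_eq (hθ : FunctionSpaces.IsTestFunctionOn (⊤ : TopologicalSpace.Opens (EuclideanSpace ℝ (Fin 3))) θ)
    (s : ℝ) (y a b e : EuclideanSpace ℝ (Fin 3)) :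
    ∫ x, ⟪oseenIntegrand s (x - y) a b, θ x • e⟫ =
      ∫ x, fderiv ℝ (heatKernel s) (x - y) b * fderiv ℝ (fun x' => fderiv ℝ θ x' e) x a := by
  have hθ2 : ContDiff ℝ 2 θ := contDiff_infty.1 hθ.contDiff 2
  have hθ1 : ContDiff ℝ 1 θ := hθ2.of_le one_le_two
  have hθc : HasCompactSupport θ := hθ.hasCompactSupport
  -- `⟪Θ(x - y), θ x • e⟫ = D_e(D_aD_bG_s)(x - y) · θ x`
  have h1 : ∀ x, ⟪oseenIntegrand s (x - y) a b, θ x • e⟫ =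
      fderiv ℝ (heatKernelD2 s a b) (x - y) e * θ x := by
    intro x
    rw [real_inner_smul_right, fderiv_heatKernelD2_apply, mul_comm]
  simp_rw [h1]
  -- first integration by parts: `D_e` onto `θ`
  rw [integral_fderiv_comp_sub_mul (contDiff_heatKernelD2 s a b) hθ1 hθc y e]
  -- `D_aD_bG_s = D_a (D_b G_s)`; second integration by parts: `D_a` onto `∂ₑθ`
  have hk : ContDiff ℝ 1 (fun w : EuclideanSpace ℝ (Fin 3) => fderiv ℝ (heatKernel s) w b) :=
    contDiff_fderiv_heatKernel_apply s b
  have hf : ContDiff ℝ 1 (fun x' : EuclideanSpace ℝ (Fin 3) => fderiv ℝ θ x' e) :=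
    (hθ2.fderiv_right (m := 1) le_rfl).clm_apply contDiff_const
  have hfc : HasCompactSupport (fun x' : EuclideanSpace ℝ (Fin 3) => fderiv ℝ θ x' e) :=
    hθc.fderiv_apply (𝕜 := ℝ) e
  have h2 := integral_fderiv_comp_sub_mul hk hf hfc y a
  have h3 : ∀ x, heatKernelD2 s a b (x - y) * fderiv ℝ θ x e =
      fderiv ℝ (fun w : EuclideanSpace ℝ (Fin 3) => fderiv ℝ (heatKernel s) w b) (x - y) a *
        fderiv ℝ θ x e := fun x => by
    rw [heatKernelD2_eq]
  simp_rw [h3]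
  rw [h2, neg_neg]

/-- **NEAR bound for the projector slice** (two derivatives on the bump, one on the Gaussian):
`|∫ ⟪Θ_s(x − y)[a,b], θ(x)e⟫ dx| ≤ |a||b||e| ∫ ‖DG_s(x − y)‖ ‖D²θ(x)‖ dx`. [folklore] -/
theorem abs_projSlice_le_near
    (hθ : FunctionSpaces.IsTestFunctionOn (⊤ : TopologicalSpace.Opens (EuclideanSpace ℝ (Fin 3))) θ)
    (s : ℝ) (y a b e : EuclideanSpace ℝ (Fin 3)) :
    |∫ x, ⟪oseenIntegrand s (x - y) a b, θ x • e⟫| ≤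
      ‖a‖ * ‖b‖ * ‖e‖ * ∫ x, ‖fderiv ℝ (heatKernel s) (x - y)‖ * ‖fderiv ℝ (fderiv ℝ θ) x‖ := by
  have hθ2 : ContDiff ℝ 2 θ := contDiff_infty.1 hθ.contDiff 2
  have hθc : HasCompactSupport θ := hθ.hasCompactSupport
  have hD2c : Continuous (fderiv ℝ (fderiv ℝ θ)) :=
    (hθ2.fderiv_right (m := 1) le_rfl).continuous_fderiv one_ne_zero
  have hD2s : HasCompactSupport (fderiv ℝ (fderiv ℝ θ)) := (hθc.fderiv (𝕜 := ℝ)).fderiv (𝕜 := ℝ)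
  have hdiff : ∀ x, DifferentiableAt ℝ (fderiv ℝ θ) x := fun x =>
    ((hθ2.fderiv_right (m := 1) le_rfl).differentiable one_ne_zero) x
  rw [projSlice_eq hθ s y a b e]
  have hpt : ∀ x, ‖fderiv ℝ (heatKernel s) (x - y) b * fderiv ℝ (fun x' => fderiv ℝ θ x' e) x a‖ ≤
      ‖a‖ * ‖b‖ * ‖e‖ * (‖fderiv ℝ (heatKernel s) (x - y)‖ * ‖fderiv ℝ (fderiv ℝ θ) x‖) := by
    intro x
    rw [fderiv_apply_const_apply (hdiff x) e a, norm_mul]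
    have h1 : ‖fderiv ℝ (heatKernel s) (x - y) b‖ ≤ ‖fderiv ℝ (heatKernel s) (x - y)‖ * ‖b‖ :=
      ContinuousLinearMap.le_opNorm _ _
    have h2 : ‖fderiv ℝ (fderiv ℝ θ) x a e‖ ≤ ‖fderiv ℝ (fderiv ℝ θ) x‖ * ‖a‖ * ‖e‖ :=
      (ContinuousLinearMap.le_opNorm _ _).trans
        (mul_le_mul_of_nonneg_right (ContinuousLinearMap.le_opNorm _ _) (norm_nonneg _))
    calc ‖fderiv ℝ (heatKernel s) (x - y) b‖ * ‖fderiv ℝ (fderiv ℝ θ) x a e‖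
        ≤ (‖fderiv ℝ (heatKernel s) (x - y)‖ * ‖b‖) * (‖fderiv ℝ (fderiv ℝ θ) x‖ * ‖a‖ * ‖e‖) :=
          mul_le_mul h1 h2 (norm_nonneg _) (by positivity)
      _ = ‖a‖ * ‖b‖ * ‖e‖ * (‖fderiv ℝ (heatKernel s) (x - y)‖ * ‖fderiv ℝ (fderiv ℝ θ) x‖) := by ring
  have hFc : Continuous fun x : EuclideanSpace ℝ (Fin 3) =>
      ‖fderiv ℝ (heatKernel s) (x - y)‖ * ‖fderiv ℝ (fderiv ℝ θ) x‖ :=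
    ((continuous_fderiv_heatKernel s).comp (continuous_id.sub continuous_const)).norm.mul hD2c.norm
  have hFs : HasCompactSupport fun x : EuclideanSpace ℝ (Fin 3) =>
      ‖fderiv ℝ (heatKernel s) (x - y)‖ * ‖fderiv ℝ (fderiv ℝ θ) x‖ :=
    (hD2s.norm : HasCompactSupport fun x => ‖fderiv ℝ (fderiv ℝ θ) x‖).mul_left
  have hint : Integrable (fun x => ‖a‖ * ‖b‖ * ‖e‖ *
      (‖fderiv ℝ (heatKernel s) (x - y)‖ * ‖fderiv ℝ (fderiv ℝ θ) x‖)) volume :=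
    (hFc.integrable_of_hasCompactSupport hFs).const_mul _
  calc |∫ x, fderiv ℝ (heatKernel s) (x - y) b * fderiv ℝ (fun x' => fderiv ℝ θ x' e) x a|
      = ‖∫ x, fderiv ℝ (heatKernel s) (x - y) b * fderiv ℝ (fun x' => fderiv ℝ θ x' e) x a‖ :=
        (Real.norm_eq_abs _).symm
    _ ≤ ∫ x, ‖a‖ * ‖b‖ * ‖e‖ * (‖fderiv ℝ (heatKernel s) (x - y)‖ * ‖fderiv ℝ (fderiv ℝ θ) x‖) :=
        norm_integral_le_of_norm_le hint (Eventually.of_forall hpt)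
    _ = _ := integral_const_mul _ _

/-- **FAR bound for the projector slice** (all three derivatives on the Gaussian):
`|∫ ⟪Θ_s(x − y)[a,b], θ(x)e⟫ dx| ≤ |a||b||e| ∫ m_s(x − y) |θ(x)| dx`, `s > 0`. [folklore] -/
theorem abs_projSlice_le_far
    (hθ : FunctionSpaces.IsTestFunctionOn (⊤ : TopologicalSpace.Opens (EuclideanSpace ℝ (Fin 3))) θ)
    {s : ℝ} (hs : 0 < s) (y a b e : EuclideanSpace ℝ (Fin 3)) :
    |∫ x, ⟪oseenIntegrand s (x - y) a b, θ x • e⟫| ≤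
      ‖a‖ * ‖b‖ * ‖e‖ * ∫ x,
        (3 * (heatKernel s (x - y) / (4 * s ^ 2)) * ‖x - y‖ + heatKernel s (x - y) / (8 * s ^ 3) * ‖x - y‖ ^ 3) *
          |θ x| := by
  have hθc : HasCompactSupport θ := hθ.hasCompactSupport
  have hθcont : Continuous θ := hθ.contDiff.continuous
  have hpt : ∀ x, ‖⟪oseenIntegrand s (x - y) a b, θ x • e⟫‖ ≤ ‖a‖ * ‖b‖ * ‖e‖ *
      ((3 * (heatKernel s (x - y) / (4 * s ^ 2)) * ‖x - y‖ + heatKernel s (x - y) / (8 * s ^ 3) * ‖x - y‖ ^ 3) *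
        |θ x|) := by
    intro x
    have hm := norm_oseenIntegrand_le_majorant hs (x - y) a b
    have hm0 := majorant_nonneg hs (x - y)
    calc ‖⟪oseenIntegrand s (x - y) a b, θ x • e⟫‖ ≤ ‖oseenIntegrand s (x - y) a b‖ * ‖θ x • e‖ :=
          norm_inner_le_norm _ _
      _ ≤ ((3 * (heatKernel s (x - y) / (4 * s ^ 2)) * ‖x - y‖ +
            heatKernel s (x - y) / (8 * s ^ 3) * ‖x - y‖ ^ 3) * ‖a‖ * ‖b‖) * (|θ x| * ‖e‖) := by
          rw [norm_smul, Real.norm_eq_abs]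
          exact mul_le_mul hm le_rfl (by positivity) (by positivity)
      _ = _ := by ring
  have hFc : Continuous fun x : EuclideanSpace ℝ (Fin 3) =>
      (3 * (heatKernel s (x - y) / (4 * s ^ 2)) * ‖x - y‖ + heatKernel s (x - y) / (8 * s ^ 3) * ‖x - y‖ ^ 3) *
        |θ x| :=
    ((continuous_majorant s).comp (continuous_id.sub continuous_const)).mul (continuous_abs.comp hθcont)
  have hFs : HasCompactSupport fun x : EuclideanSpace ℝ (Fin 3) =>
      (3 * (heatKernel s (x - y) / (4 * s ^ 2)) * ‖x - y‖ + heatKernel s (x - y) / (8 * s ^ 3) * ‖x - y‖ ^ 3) *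
        |θ x| :=
    (hθc.norm : HasCompactSupport fun x => ‖θ x‖).mul_left
  have hint : Integrable (fun x => ‖a‖ * ‖b‖ * ‖e‖ *
      ((3 * (heatKernel s (x - y) / (4 * s ^ 2)) * ‖x - y‖ + heatKernel s (x - y) / (8 * s ^ 3) * ‖x - y‖ ^ 3) *
        |θ x|)) volume :=
    (hFc.integrable_of_hasCompactSupport hFs).const_mul _
  rw [← Real.norm_eq_abs, ← integral_const_mul]
  exact norm_integral_le_of_norm_le hint (Eventually.of_forall hpt)

/-- **The heat part against a scalar bump**:
`∫ (D_aG_σ)(x − y) ⟪b, θ(x)e⟫ dx = −⟪b,e⟫ ∫ G_σ(x − y) ∂ₐθ(x) dx` (one integration by parts).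
[cite: KochTataruAdvMath2001, §2 (8)] -/
theorem heatPart_eq (hθ : FunctionSpaces.IsTestFunctionOn (⊤ : TopologicalSpace.Opens (EuclideanSpace ℝ (Fin 3))) θ)
    (σ : ℝ) (y a b e : EuclideanSpace ℝ (Fin 3)) :
    ∫ x, fderiv ℝ (heatKernel σ) (x - y) a * ⟪b, θ x • e⟫ =
      -(⟪b, e⟫ * ∫ x, heatKernel σ (x - y) * fderiv ℝ θ x a) := by
  have hθ1 : ContDiff ℝ 1 θ := contDiff_infty.1 hθ.contDiff 1
  have hθc : HasCompactSupport θ := hθ.hasCompactSupport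
  have h1 : ∀ x, fderiv ℝ (heatKernel σ) (x - y) a * ⟪b, θ x • e⟫ =
      ⟪b, e⟫ * (fderiv ℝ (heatKernel σ) (x - y) a * θ x) := by
    intro x
    rw [real_inner_smul_right]
    ring
  simp_rw [h1]
  rw [integral_const_mul, integral_fderiv_comp_sub_mul (contDiff_heatKernel_space σ) hθ1 hθc y a,
    mul_neg]

/-- **Bound for the heat part** (`σ > 0`): `|∫ (D_aG_σ)(x − y) ⟪b, θ(x)e⟫ dx| ≤ |a||b||e| ∫ G_σ(x − y) ‖Dθ(x)‖ dx`.
[folklore] -/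
theorem abs_heatPart_le (hθ : FunctionSpaces.IsTestFunctionOn (⊤ : TopologicalSpace.Opens (EuclideanSpace ℝ (Fin 3))) θ)
    {σ : ℝ} (hσ : 0 < σ) (y a b e : EuclideanSpace ℝ (Fin 3)) :
    |∫ x, fderiv ℝ (heatKernel σ) (x - y) a * ⟪b, θ x • e⟫| ≤
      ‖a‖ * ‖b‖ * ‖e‖ * ∫ x, heatKernel σ (x - y) * ‖fderiv ℝ θ x‖ := by
  have hθ1 : ContDiff ℝ 1 θ := contDiff_infty.1 hθ.contDiff 1
  have hθc : HasCompactSupport θ := hθ.hasCompactSupport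
  have hDc : Continuous (fderiv ℝ θ) := hθ1.continuous_fderiv one_ne_zero
  have hDs : HasCompactSupport (fderiv ℝ θ) := hθc.fderiv (𝕜 := ℝ)
  rw [heatPart_eq hθ σ y a b e, abs_neg, abs_mul]
  have hpt : ∀ x, ‖heatKernel σ (x - y) * fderiv ℝ θ x a‖ ≤ ‖a‖ * (heatKernel σ (x - y) * ‖fderiv ℝ θ x‖) := by
    intro x
    rw [norm_mul, Real.norm_of_nonneg (heatKernel_pos hσ _).le]
    calc heatKernel σ (x - y) * ‖fderiv ℝ θ x a‖ ≤ heatKernel σ (x - y) * (‖fderiv ℝ θ x‖ * ‖a‖) :=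
          mul_le_mul_of_nonneg_left (ContinuousLinearMap.le_opNorm _ _) (heatKernel_pos hσ _).le
      _ = ‖a‖ * (heatKernel σ (x - y) * ‖fderiv ℝ θ x‖) := by ring
  have hFc : Continuous fun x : EuclideanSpace ℝ (Fin 3) => heatKernel σ (x - y) * ‖fderiv ℝ θ x‖ :=
    ((continuous_heatKernel σ).comp (continuous_id.sub continuous_const)).mul hDc.norm
  have hFs : HasCompactSupport fun x : EuclideanSpace ℝ (Fin 3) => heatKernel σ (x - y) * ‖fderiv ℝ θ x‖ :=
    (hDs.norm : HasCompactSupport fun x => ‖fderiv ℝ θ x‖).mul_left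
  have hint : Integrable (fun x => ‖a‖ * (heatKernel σ (x - y) * ‖fderiv ℝ θ x‖)) volume :=
    (hFc.integrable_of_hasCompactSupport hFs).const_mul _
  have hI : |∫ x, heatKernel σ (x - y) * fderiv ℝ θ x a| ≤ ‖a‖ * ∫ x, heatKernel σ (x - y) * ‖fderiv ℝ θ x‖ := by
    rw [← Real.norm_eq_abs, ← integral_const_mul]
    exact norm_integral_le_of_norm_le hint (Eventually.of_forall hpt)
  have hI0 : 0 ≤ ∫ x, heatKernel σ (x - y) * ‖fderiv ℝ θ x‖ :=
    integral_nonneg fun x => mul_nonneg (heatKernel_pos hσ _).le (norm_nonneg _)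
  calc |⟪b, e⟫| * |∫ x, heatKernel σ (x - y) * fderiv ℝ θ x a|
      ≤ (‖b‖ * ‖e‖) * (‖a‖ * ∫ x, heatKernel σ (x - y) * ‖fderiv ℝ θ x‖) :=
        mul_le_mul (abs_real_inner_le_norm _ _) hI (abs_nonneg _) (by positivity)
    _ = _ := by ring

end Pairing

end Summit.NavierStokesRegularity.NavierStokesRegularity.Theorems.PoloidalWindowDoorPoloidalWindowRigidityOseenBumpPairing

end
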